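import Summits.BirchSwinnertonDyer.Rank1Residual.Partition.EisensteinKernelCertificate
import HarnessLib

/-!
# The kernel discriminant of a rational `3`-line is the square class of `b₂ + 12·x₀`
# (the flex identity `16·Ψ₃ = 2·Ψ₂Sq·Ψ₂Sq″ − (Ψ₂Sq′)²`); parity = side of the inflection abscissa `−b₂/12`

HONEST FRAMING (cell `b2b-bsdres-*`, verbatim): the goal of the cell is to DELETE the
COMBINATION-SHAPED residual classes for ALL analytic-rank ≤ 1 curves over ℚ — "full BSD formula
for every rank ≤ 1 curve in class C" assembled STRICTLY from published theorems — so that the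
rank-≤1 remainder becomes exactly the CONSTRUCTION-SHAPED classes, which are TYPED (missing-input
Props), NOT attempted; this is not "finishing BSD". Off-peak literature typer `b2b-bsdres-lit-cgls`
(CGLS22 / GV00, the reducible = Eisenstein column), session 13: files 5–7 of the elementary-reduction
series `EisensteinKernelCharacter` → `EisensteinKernelDiscriminant` → `EisensteinKernelDiscriminantType`
→ `EisensteinKernelCertificate` (sessions 11–12) are `EisensteinKernelAbscissa` (this file) →
`EisensteinKernelAbscissaIntegral` → `EisensteinKernelAbscissaType`. Theorems only — no definition, no
named fact, nothing booked, no label changed; research-route bookkeeping, no claim about BSD is made.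

Sessions 11–12 attached to every rational `3`-line `Φ ≤ E[3]` of `E/ℚ` (with `E[3]` reducible) ONE
squarefree integer `D ≠ 0` — the KERNEL DISCRIMINANT: `(∀ P ∈ Φ, σP = P) ↔ σ√D = √D` —, read the
Greenberg–Vatsal parity type at `3` as `GVPar W 3 ↔ (0 < D ↔ 3 ∣ D)` (good ordinary or multiplicative
`3`), and made `D` checkable through the certificate `(x₀, D, s)`: `Ψ₃(x₀) = 0`,
`D·s² = Ψ₂Sq(x₀) = 4x₀³ + b₂x₀² + 2b₄x₀ + b₆`. This file CLOSES the formula for `D`: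

* §13 THE FLEX IDENTITY `16·Ψ₃ = 2·Ψ₂Sq·Ψ₂Sq″ − (Ψ₂Sq′)²` (`sixteen_mul_eval_Ψ₃`; any commutative ring;
  `Ψ₂Sq′ = 12X² + 2b₂X + 2b₄`, `Ψ₂Sq″ = 24X + 2b₂`; Mathlib's `b_relation` `4b₈ = b₂b₆ − b₄²`). Hence at
  a root `x₀` of `Ψ₃`: `Ψ₂Sq(x₀)·4(b₂ + 12x₀) = Ψ₂Sq′(x₀)²` (`eval_Ψ₂Sq_mul_eq_sq_of_eval_Ψ₃`); for an
  ELLIPTIC curve `Ψ₂Sq(x₀) ≠ 0` automatically (`eval_Ψ₂Sq_ne_zero_of_eval_Ψ₃`: else `Ψ₂Sq` and `Ψ₂Sq′`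
  share the root `x₀`, `c₄x₀ = 18b₆ − b₂b₄`, and `Δ = 0` — so the hypothesis `Ψ₂Sq(x₀) ≠ 0` of session
  12's §9–§11 is DISCHARGED, `exists_cert_of_eval_Ψ₃_eq_zero'`), and `b₂ + 12x₀ ≠ 0` as soon as
  `c₄ ≠ 0` (`b₂_add_ne_zero_of_eval_Ψ₃`).
* §14 **`D ≡ b₂ + 12·x₀ (mod squares)`** (`exists_mul_sq_eq_b₂_add`): the kernel character of ANY
  rational `3`-line is `χ_{b₂ + 12x₀}` for the (rational) abscissa `x₀` of any of its non-zero points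
  (`eval_Ψ₃_eq_zero_of_mem` — abscissas of rational-`3`-line points are roots of `Ψ₃` —,
  `kernelChar_iff_abscissa`, `exists_kernelDisc_abscissa`), and the PARITY of the line is the SIDE of
  `x₀` relative to the inflection abscissa `−b₂/12` of the `2`-division cubic:
  `LineEven W 3 Φ ↔ 0 < b₂ + 12x₀`, `LineOdd W 3 Φ ↔ b₂ + 12x₀ < 0` (`lineEven_three_iff_abscissa`,
  `lineOdd_three_iff_abscissa`; hypothesis `c₄ ≠ 0`, i.e. `j ≠ 0`); the hypothesis-light type-B
  certificate `gvPar_three_of_linCert` (`Ψ₃(x₀) = 0`, `D·t² = b₂ + 12x₀`, `D` squarefree,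
  `(0 < D ↔ 3 ∣ D)`), worked in §14c on session 12's row `[1, −2, 1, 220, 1972]` (`b₂ = −7`):
  `x₀ = −14 ↦ b₂ + 12x₀ = −175 = (−7)·5²`, `x₀ = 7/3 ↦ 21 = 21·1²` — both type B, by two `norm_num`
  lines each (session 12 needed `Ψ₂Sq(−14) = −16807 = (−7)·49²`, `Ψ₂Sq(7/3) = 268912/27 = 21·(196/9)²`).

The sequel files read RAMIFICATION at `3` off the abscissa (`3 ∣ D ↔ x₀ ∉ ℤ` on integral models
with `3 ∤ b₂`, `EisensteinKernelAbscissaIntegral`) and assemble the verdict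
`GVPar W 3 ↔ (0 < b₂ + 12x₀ ↔ x₀ ∉ ℤ)` at a good ordinary / multiplicative `3`
(`EisensteinKernelAbscissaType`). CONSUMERS (EVIDENCE joins of the class-closure lane, nothing booked):
cc-typer-6's `KDISC3` certificate `(x₀, d)` and cc-eng-1's engine E3L
(`HOME/class-closure/eng-1/KDISC3-CLASSLINES-cceng1.md`, 49 144 rational `3`-lines).

References: J. H. Silverman, *The Arithmetic of Elliptic Curves*, GTM 106 (2009), III.1 (the
`bᵢ`, `cᵢ`, `4b₈ = b₂b₆ − b₄²`, `Δ`), III.2.3, Exercise 3.7 (division polynomials) [SilvermanAEC2009];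
R. Greenberg, V. Vatsal, Invent. Math. 142 (2000), Thm. (1.3) (the parity condition)
[GreenbergVatsal2000]; HOME/b2b-bsdres-lit-cgls/CGLS-GV-TYPING.md §§18–20.
-/

set_option autoImplicit false

noncomputable section

open scoped Classical NumberField

open WeierstrassCurve Polynomial Literature.NumberTheory.EllipticCurves
  Literature.NumberTheory.EllipticCurves.Rank1Residual Field IsDedekindDomain

namespace Summit.BirchSwinnertonDyer.Rank1Residual

namespace KernelDisc

variable {W : WeierstrassCurve ℚ}

/-! ### §13. The flex identity and its consequences at a root of `Ψ₃` -/

/-- **`16·Ψ₃ = 2·Ψ₂Sq·Ψ₂Sq″ − (Ψ₂Sq′)²`** (evaluated; any commutative ring): with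
`Ψ₂Sq = 4X³ + b₂X² + 2b₄X + b₆`, `Ψ₂Sq′ = 12X² + 2b₂X + 2b₄`, `Ψ₂Sq″ = 24X + 2b₂` and Mathlib's
`Ψ₃ = 3X⁴ + b₂X³ + 3b₄X² + 3b₆X + b₈`, the two sides differ by `4·(4b₈ − b₂b₆ + b₄²) = 0`
(`WeierstrassCurve.b_relation`). Silverman *AEC* III.1, Ex. 3.7. [folklore] -/
theorem sixteen_mul_eval_Ψ₃ {R : Type*} [CommRing R] (V : WeierstrassCurve R) (x : R) :
    16 * V.Ψ₃.eval x =
      2 * V.Ψ₂Sq.eval x * (24 * x + 2 * V.b₂) - (12 * x ^ 2 + 2 * V.b₂ * x + 2 * V.b₄) ^ 2 := by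
  rw [eval_Ψ₂Sq]
  simp only [WeierstrassCurve.Ψ₃, eval_add, eval_mul, eval_pow, eval_C, eval_X, eval_ofNat]
  linear_combination (4 : R) * V.b_relation

/-- **At a root `x₀` of `Ψ₃`: `Ψ₂Sq(x₀) · 4(b₂ + 12x₀) = Ψ₂Sq′(x₀)²`.** [folklore] -/
theorem eval_Ψ₂Sq_mul_eq_sq_of_eval_Ψ₃ {K : Type*} [CommRing K] (V : WeierstrassCurve K) {x₀ : K}
    (hψ : V.Ψ₃.eval x₀ = 0) :
    V.Ψ₂Sq.eval x₀ * (4 * (V.b₂ + 12 * x₀)) = (12 * x₀ ^ 2 + 2 * V.b₂ * x₀ + 2 * V.b₄) ^ 2 := by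
  have h := sixteen_mul_eval_Ψ₃ V x₀
  rw [hψ, mul_zero] at h
  linear_combination (-1 : K) * h

/-- **For an elliptic curve over `ℚ`, `Ψ₂Sq` does not vanish at a root of `Ψ₃`** (a common root
`x₀` of `Ψ₂Sq` and `Ψ₃` is a common root of `Ψ₂Sq` and `Ψ₂Sq′` by the flex identity, i.e. the NODE
abscissa `c₄x₀ = 18b₆ − b₂b₄`, and then `−144·Δ = c₄²·Ψ₂Sq′(x₀) − (c₄x₀ − 18b₆ + b₂b₄)·(…) = 0`).
This discharges the hypothesis `W.Ψ₂Sq.eval x₀ ≠ 0` of session 12's §9–§11. Silverman *AEC*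
III.1 (`Δ ≠ 0` iff the cubic `4x³ + b₂x² + 2b₄x + b₆` is separable). [folklore] -/
theorem eval_Ψ₂Sq_ne_zero_of_eval_Ψ₃ [W.IsElliptic] {x₀ : ℚ} (hψ : W.Ψ₃.eval x₀ = 0) :
    W.Ψ₂Sq.eval x₀ ≠ 0 := by
  intro hF
  have hsq := eval_Ψ₂Sq_mul_eq_sq_of_eval_Ψ₃ W hψ
  rw [hF, zero_mul] at hsq
  have hF' : 12 * x₀ ^ 2 + 2 * W.b₂ * x₀ + 2 * W.b₄ = 0 := (pow_eq_zero_iff two_ne_zero).mp hsq.symm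
  rw [eval_Ψ₂Sq] at hF
  -- the node abscissa relation `c₄·x₀ = 18b₆ − b₂b₄`
  have hR : (W.b₂ ^ 2 - 24 * W.b₄) * x₀ - (18 * W.b₆ - W.b₂ * W.b₄) = 0 := by
    linear_combination (1 / 2 : ℚ) * (12 * x₀ + W.b₂) * hF' - 18 * hF
  have hb := W.b_relation
  have hΔ : -W.b₂ ^ 2 * W.b₈ - 8 * W.b₄ ^ 3 - 27 * W.b₆ ^ 2 + 9 * W.b₂ * W.b₄ * W.b₆ = 0 := by
    linear_combination (-(1 : ℚ) / 144) * ((W.b₂ ^ 2 - 24 * W.b₄) ^ 2 * hF' -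
      (12 * ((W.b₂ ^ 2 - 24 * W.b₄) * x₀ - (18 * W.b₆ - W.b₂ * W.b₄)) + 24 * (18 * W.b₆ - W.b₂ * W.b₄) +
        2 * W.b₂ * (W.b₂ ^ 2 - 24 * W.b₄)) * hR) - (W.b₂ ^ 2 / 4) * hb
  exact W.isUnit_Δ.ne_zero hΔ

/-- Session 12's `exists_cert_of_eval_Ψ₃_eq_zero` with the hypothesis `Ψ₂Sq(x₀) ≠ 0` DISCHARGED:
**every rational root of `Ψ₃` yields a rational `3`-line and a certificate `(D, s)`.** [folklore] -/
theorem exists_cert_of_eval_Ψ₃_eq_zero' [W.IsElliptic] (x₀ : ℚ) (hψ : W.Ψ₃.eval x₀ = 0) :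
    ∃ (Φ : AddSubgroup (geomTorsion W ((3 : ℕ) : ℤ))) (D : ℤ) (s : ℚ), IsRationalLine W 3 Φ ∧
      Squarefree D ∧ D ≠ 0 ∧ s ≠ 0 ∧ (D : ℚ) * s ^ 2 = W.Ψ₂Sq.eval x₀ ∧
      ∀ σ : absoluteGaloisGroup ℚ, (∀ Q ∈ Φ, σ • Q = Q) ↔ σ • geomSqrt (D : ℚ) = geomSqrt (D : ℚ) :=
  exists_cert_of_eval_Ψ₃_eq_zero x₀ hψ (eval_Ψ₂Sq_ne_zero_of_eval_Ψ₃ hψ)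

/-- **`b₂ + 12x₀ ≠ 0` at a root of `Ψ₃` when `c₄ ≠ 0` (`j ≠ 0`)**: otherwise `Ψ₂Sq′(x₀) = 0` too,
`b₂ = −12x₀`, `b₄ = 6x₀²` and `c₄ = b₂² − 24b₄ = 0`. [folklore] -/
theorem b₂_add_ne_zero_of_eval_Ψ₃ {x₀ : ℚ} (hψ : W.Ψ₃.eval x₀ = 0) (hc₄ : W.c₄ ≠ 0) :
    W.b₂ + 12 * x₀ ≠ 0 := by
  intro h0
  have hsq := eval_Ψ₂Sq_mul_eq_sq_of_eval_Ψ₃ W hψ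
  rw [h0, mul_zero, mul_zero] at hsq
  have hF' : 12 * x₀ ^ 2 + 2 * W.b₂ * x₀ + 2 * W.b₄ = 0 := (pow_eq_zero_iff two_ne_zero).mp hsq.symm
  apply hc₄
  simp only [WeierstrassCurve.c₄]
  linear_combination (W.b₂ + 12 * x₀) * h0 - 12 * hF'

/-- **`Ψ₂Sq(x₀) = (b₂ + 12x₀)·u²`, `u = Ψ₂Sq′(x₀)/(2(b₂ + 12x₀)) ∈ ℚˣ`** at a root `x₀` of `Ψ₃`
with `b₂ + 12x₀ ≠ 0` (elliptic curve over `ℚ`). [folklore] -/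
theorem exists_eval_Ψ₂Sq_eq_mul_sq [W.IsElliptic] {x₀ : ℚ} (hψ : W.Ψ₃.eval x₀ = 0)
    (hne : W.b₂ + 12 * x₀ ≠ 0) :
    ∃ u : ℚ, u ≠ 0 ∧ W.Ψ₂Sq.eval x₀ = (W.b₂ + 12 * x₀) * u ^ 2 := by
  have hF := eval_Ψ₂Sq_ne_zero_of_eval_Ψ₃ hψ
  have hsq := eval_Ψ₂Sq_mul_eq_sq_of_eval_Ψ₃ W hψ
  set F' := 12 * x₀ ^ 2 + 2 * W.b₂ * x₀ + 2 * W.b₄ with hF'def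
  have hF'0 : F' ≠ 0 := by
    intro h
    rw [h, zero_pow two_ne_zero] at hsq
    rcases mul_eq_zero.mp hsq with h1 | h1
    · exact hF h1
    · exact hne (by linarith)
  refine ⟨F' / (2 * (W.b₂ + 12 * x₀)), div_ne_zero hF'0 (mul_ne_zero two_ne_zero hne), ?_⟩
  field_simp
  linear_combination hsq

/-! ### §14. The kernel discriminant is the square class of `b₂ + 12·x₀`; parity from the abscissa -/

/-- **`D ≡ b₂ + 12x₀ (mod squares)`**: a certificate `D·s² = Ψ₂Sq(x₀)` (`D ≠ 0`, `s ≠ 0`) at a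
root `x₀` of `Ψ₃` with `b₂ + 12x₀ ≠ 0` gives `D·t² = b₂ + 12x₀` with `t = Ψ₂Sq′(x₀)/(2Ds) ≠ 0`.
[folklore] -/
theorem exists_mul_sq_eq_b₂_add [W.IsElliptic] {x₀ s : ℚ} {D : ℤ} (hψ : W.Ψ₃.eval x₀ = 0)
    (hne : W.b₂ + 12 * x₀ ≠ 0) (hD0 : D ≠ 0) (hs : s ≠ 0) (hDs : (D : ℚ) * s ^ 2 = W.Ψ₂Sq.eval x₀) :
    ∃ t : ℚ, t ≠ 0 ∧ (D : ℚ) * t ^ 2 = W.b₂ + 12 * x₀ := by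
  obtain ⟨u, hu, hFu⟩ := exists_eval_Ψ₂Sq_eq_mul_sq hψ hne
  have hD0' : (D : ℚ) ≠ 0 := Int.cast_ne_zero.mpr hD0
  -- `D s² = (b₂ + 12x₀) u²`, so `b₂ + 12x₀ = D (s/u)²`
  refine ⟨s / u, div_ne_zero hs hu, ?_⟩
  rw [hFu] at hDs
  field_simp
  linear_combination hDs

/-- **Abscissas of rational-`3`-line points are roots of `Ψ₃`.** For a rational `3`-line `Φ` and
`P ∈ Φ ∖ 0` written `P = (x₀, y)` with `x₀ ∈ ℚ` (session 11's `exists_disc_of_mem` provides such a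
presentation): `Ψ₃(x₀) = 0` (the converse half of the tree's triplication formula
`WeierstrassCurve.three_smul_some_eq_zero_iff`; `2P ≠ 0` on a line of order `3`). Silverman *AEC*
Ex. 3.7. [folklore] -/
theorem eval_Ψ₃_eq_zero_of_mem {Φ : AddSubgroup (geomTorsion W ((3 : ℕ) : ℤ))}
    (hΦ : IsRationalLine W 3 Φ) {P : geomTorsion W ((3 : ℕ) : ℤ)} (hP : P ∈ Φ) (hP0 : P ≠ 0)
    {x₀ : ℚ} {y : AlgebraicClosure ℚ}
    {h : (W.baseChange (AlgebraicClosure ℚ)).toAffine.Nonsingular (algebraMap ℚ (AlgebraicClosure ℚ) x₀) y}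
    (hPe : (P : W.geomPoints) = Affine.Point.some (algebraMap ℚ (AlgebraicClosure ℚ) x₀) y h) :
    W.Ψ₃.eval x₀ = 0 := by
  have h32 : (3 : ℕ) ≠ 2 := by decide
  -- `y ≠ −y − a₁x₀ − a₃`: otherwise `ψ₂(P) = 2y + a₁x₀ + a₃ = 0`, i.e. `2P = 0`
  have hy : y ≠ (W.baseChange (AlgebraicClosure ℚ)).toAffine.negY (algebraMap ℚ (AlgebraicClosure ℚ) x₀) y := by
    intro e
    have h2 : (2 : ℤ) • (Affine.Point.some (algebraMap ℚ (AlgebraicClosure ℚ) x₀) y h :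
        (W.baseChange (AlgebraicClosure ℚ)).toAffine.Point) = 0 := by
      refine (WeierstrassCurve.two_smul_some_eq_zero_iff h).mpr ?_
      rw [ψ_two, WeierstrassCurve.ψ₂, Affine.evalEval_polynomialY]
      rw [Affine.negY] at e
      linear_combination e
    apply two_smul_coe_ne_zero hΦ h32 hP hP0
    rw [← natCast_zsmul, hPe, Nat.cast_ofNat]
    exact h2
  have h3 : ((3 : ℕ) : ℤ) • (P : W.geomPoints) = 0 := mem_torsionBy_iff.mp P.2
  rw [hPe, Nat.cast_ofNat] at h3
  have hev := (WeierstrassCurve.three_smul_some_eq_zero_iff h hy).mp h3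
  rw [ψ_three, evalEval_C, eval_Ψ₃_baseChange] at hev
  exact (map_eq_zero_iff _ (algebraMap ℚ (AlgebraicClosure ℚ)).injective).mp hev

/-- **The kernel character of a rational `3`-line is `χ_{b₂ + 12x₀}`**, `x₀` the abscissa of any
of its non-zero points, provided `c₄ ≠ 0` (`j ≠ 0`): `(∀ Q ∈ Φ, σQ = Q) ↔ σ√(b₂ + 12x₀) = √(b₂ + 12x₀)`.
(Session 11: the character is `χ_{Ψ₂Sq(x₀)}`; §13: `Ψ₂Sq(x₀) = (b₂ + 12x₀)·u²`.) [folklore] -/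
theorem kernelChar_iff_abscissa [W.IsElliptic] {Φ : AddSubgroup (geomTorsion W ((3 : ℕ) : ℤ))}
    (hΦ : IsRationalLine W 3 Φ) {P : geomTorsion W ((3 : ℕ) : ℤ)} (hP : P ∈ Φ) (hP0 : P ≠ 0)
    {x₀ : ℚ} {y : AlgebraicClosure ℚ}
    {h : (W.baseChange (AlgebraicClosure ℚ)).toAffine.Nonsingular (algebraMap ℚ (AlgebraicClosure ℚ) x₀) y}
    (hPe : (P : W.geomPoints) = Affine.Point.some (algebraMap ℚ (AlgebraicClosure ℚ) x₀) y h)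
    (hc₄ : W.c₄ ≠ 0) (σ : absoluteGaloisGroup ℚ) :
    (∀ Q ∈ Φ, σ • Q = Q) ↔ σ • geomSqrt (W.b₂ + 12 * x₀) = geomSqrt (W.b₂ + 12 * x₀) := by
  have h32 : (3 : ℕ) ≠ 2 := by decide
  have hq := isQuadratic_three hΦ
  obtain ⟨x₁, y₁, h₁, hPe₁, -, hχ₁⟩ := exists_disc_of_mem hΦ h32 hq hP hP0
  -- the abscissa found by `exists_disc_of_mem` is `x₀`
  have hx : x₁ = x₀ := by
    have e := hPe₁.symm.trans hPe
    injection e with ex _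
    exact (algebraMap ℚ (AlgebraicClosure ℚ)).injective ex
  subst hx
  have hψ : W.Ψ₃.eval x₁ = 0 := eval_Ψ₃_eq_zero_of_mem hΦ hP hP0 hPe
  have hne := b₂_add_ne_zero_of_eval_Ψ₃ hψ hc₄
  obtain ⟨u, hu, hFu⟩ := exists_eval_Ψ₂Sq_eq_mul_sq hψ hne
  rw [forall_smul_eq_iff_of_mem hΦ hP hP0 σ, hχ₁ σ]
  rw [eval_Ψ₂Sq] at hFu
  exact smul_geomSqrt_iff_of_eq_mul_sq hne hu hFu σ

/-- Sign bookkeeping: `0 < D ↔ 0 < D·t²` for `t ≠ 0`. [folklore] -/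
theorem int_pos_iff_mul_sq_pos {D : ℤ} {t : ℚ} (ht : t ≠ 0) : (0 : ℤ) < D ↔ (0 : ℚ) < D * t ^ 2 := by
  have ht2 : (0 : ℚ) < t ^ 2 := by positivity
  rw [mul_pos_iff_of_pos_right ht2]
  exact ⟨fun hD ↦ by exact_mod_cast hD, fun hD ↦ by exact_mod_cast hD⟩

/-- Sign bookkeeping: `D < 0 ↔ D·t² < 0` for `t ≠ 0`. [folklore] -/
theorem int_neg_iff_mul_sq_neg {D : ℤ} {t : ℚ} (ht : t ≠ 0) : D < (0 : ℤ) ↔ (D : ℚ) * t ^ 2 < 0 := by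
  have ht2 : (0 : ℚ) < t ^ 2 := by positivity
  constructor
  · intro hD
    exact mul_neg_of_neg_of_pos (by exact_mod_cast hD) ht2
  · intro hDt
    have hD : (D : ℚ) < 0 := by
      by_contra hge
      rw [not_lt] at hge
      exact absurd hDt (not_lt.mpr (mul_nonneg hge ht2.le))
    exact_mod_cast hD

section Parity

variable [W.IsElliptic] {Φ : AddSubgroup (geomTorsion W ((3 : ℕ) : ℤ))}
  (hΦ : IsRationalLine W 3 Φ) {P : geomTorsion W ((3 : ℕ) : ℤ)} (hP : P ∈ Φ) (hP0 : P ≠ 0)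
  {x₀ : ℚ} {y : AlgebraicClosure ℚ}
  {h : (W.baseChange (AlgebraicClosure ℚ)).toAffine.Nonsingular (algebraMap ℚ (AlgebraicClosure ℚ) x₀) y}
  (hPe : (P : W.geomPoints) = Affine.Point.some (algebraMap ℚ (AlgebraicClosure ℚ) x₀) y h)
  (hc₄ : W.c₄ ≠ 0)

include hΦ hP hP0 hPe hc₄

/-- An INTEGER kernel discriminant in the square class of `b₂ + 12x₀`, with its two characters
(fixers / negators), for the line through `(x₀, y)`. [folklore] -/
theorem exists_kernelDisc_abscissa :
    ∃ (D : ℤ) (t : ℚ), Squarefree D ∧ D ≠ 0 ∧ t ≠ 0 ∧ W.b₂ + 12 * x₀ = D * t ^ 2 ∧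
      (∀ σ : absoluteGaloisGroup ℚ, (∀ Q ∈ Φ, σ • Q = Q) ↔ σ • geomSqrt (D : ℚ) = geomSqrt (D : ℚ)) ∧
      (∀ σ : absoluteGaloisGroup ℚ, (∀ Q ∈ Φ, σ • Q = -Q) ↔ σ • geomSqrt (D : ℚ) = -geomSqrt (D : ℚ)) := by
  have h32 : (3 : ℕ) ≠ 2 := by decide
  have hψ : W.Ψ₃.eval x₀ = 0 := eval_Ψ₃_eq_zero_of_mem hΦ hP hP0 hPe
  have hne := b₂_add_ne_zero_of_eval_Ψ₃ hψ hc₄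
  obtain ⟨D, t, hsq, hD0, ht, hDt⟩ := exists_squarefree_mul_sq (W.b₂ + 12 * x₀) hne
  have hχ : ∀ σ : absoluteGaloisGroup ℚ,
      (∀ Q ∈ Φ, σ • Q = Q) ↔ σ • geomSqrt (D : ℚ) = geomSqrt (D : ℚ) := fun σ ↦ by
    rw [kernelChar_iff_abscissa hΦ hP hP0 hPe hc₄ σ]
    exact smul_geomSqrt_iff_of_eq_mul_sq (Int.cast_ne_zero.mpr hD0) ht hDt σ
  exact ⟨D, t, hsq, hD0, ht, hDt, hχ, forall_smul_eq_neg_iff hΦ h32 (isQuadratic_three hΦ) hD0 hχ⟩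

/-- **PARITY FROM THE ABSCISSA: the line is EVEN iff `x₀ > −b₂/12`**, i.e. iff `0 < b₂ + 12x₀`
(complex conjugation fixes `√(b₂ + 12x₀)` iff it is real; `−b₂/12` is the inflection abscissa of the
`2`-division cubic `4x³ + b₂x² + 2b₄x + b₆`). Hypothesis `c₄ ≠ 0`. [folklore] -/
theorem lineEven_three_iff_abscissa : LineEven W 3 Φ ↔ 0 < W.b₂ + 12 * x₀ := by
  have h32 : (3 : ℕ) ≠ 2 := by decide
  obtain ⟨D, t, -, hD0, ht, hDt, hχ, hχ'⟩ := exists_kernelDisc_abscissa hΦ hP hP0 hPe hc₄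
  rw [lineEven_iff_pos hΦ h32 hD0 hχ hχ', hDt]
  exact int_pos_iff_mul_sq_pos ht

/-- **The line is ODD iff `x₀ < −b₂/12`**, i.e. iff `b₂ + 12x₀ < 0`. Hypothesis `c₄ ≠ 0`. [folklore] -/
theorem lineOdd_three_iff_abscissa : LineOdd W 3 Φ ↔ W.b₂ + 12 * x₀ < 0 := by
  have h32 : (3 : ℕ) ≠ 2 := by decide
  obtain ⟨D, t, -, hD0, ht, hDt, hχ, hχ'⟩ := exists_kernelDisc_abscissa hΦ hP hP0 hPe hc₄
  rw [lineOdd_iff_neg hΦ h32 hD0 hχ hχ', hDt]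
  exact int_neg_iff_mul_sq_neg ht

end Parity

/-! ### §14b. Type B from a linear certificate -/

/-- **Type B from a LINEAR certificate** (no reduction hypothesis): `Ψ₃(x₀) = 0`, `D` squarefree,
`t ≠ 0`, `D·t² = b₂ + 12x₀` and `(0 < D ↔ 3 ∣ D)` give `GVPar W 3` (session 12's `gvPar_three_of_cert`
fed by §13–§14: `Ψ₂Sq(x₀) = (b₂ + 12x₀)·u² = D·(tu)²`). [folklore] -/
theorem gvPar_three_of_linCert [W.IsElliptic] {x₀ t : ℚ} {D : ℤ} (hψ : W.Ψ₃.eval x₀ = 0)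
    (hsq : Squarefree D) (ht : t ≠ 0) (hDt : (D : ℚ) * t ^ 2 = W.b₂ + 12 * x₀)
    (h : 0 < D ↔ (3 : ℤ) ∣ D) : GVPar W 3 := by
  have hne : W.b₂ + 12 * x₀ ≠ 0 := by
    rw [← hDt]
    exact mul_ne_zero (Int.cast_ne_zero.mpr hsq.ne_zero) (pow_ne_zero 2 ht)
  obtain ⟨u, hu, hFu⟩ := exists_eval_Ψ₂Sq_eq_mul_sq hψ hne
  have hDs : (D : ℚ) * (t * u) ^ 2 = W.Ψ₂Sq.eval x₀ := by rw [hFu, ← hDt]; ring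
  exact gvPar_three_of_cert hψ hsq (mul_ne_zero ht hu) hDs h

/-! ### §14c. Session 12's worked row, now read off `b₂ + 12·x₀`

`W = [1, −2, 1, 220, 1972]` (the twist by `−7` of `14a1`'s model; `b₂ = −7`): `x₀ = −14 ↦
b₂ + 12x₀ = −175 = (−7)·5²` (`D = −7 < 0`, `3 ∤ D`: odd unramified — `x₀ ∈ ℤ`, `x₀ < 7/12 = −b₂/12`);
`x₀ = 7/3 ↦ b₂ + 12x₀ = 21 = 21·1²` (`D = 21 > 0`, `3 ∣ D`: even ramified — `x₀ ∉ ℤ`, `x₀ > 7/12`).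
Both type B, as session 12 certified from `Ψ₂Sq`. -/

/-- The twist by `−7` of `14a1`'s model, linear certificate at `x₀ = −14`: `GVPar W 3`. [folklore] -/
example : GVPar (⟨1, -2, 1, 220, 1972⟩ : WeierstrassCurve ℚ) 3 := by
  haveI : (⟨1, -2, 1, 220, 1972⟩ : WeierstrassCurve ℚ).IsElliptic := ⟨by
    rw [isUnit_iff_ne_zero]
    norm_num [WeierstrassCurve.Δ, WeierstrassCurve.b₂, WeierstrassCurve.b₄, WeierstrassCurve.b₆,
      WeierstrassCurve.b₈]⟩
  refine gvPar_three_of_linCert (x₀ := -14) (t := 5) (D := -7) ?_ ?_ (by norm_num) ?_ (by decide)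
  · simp only [WeierstrassCurve.Ψ₃, eval_add, eval_mul, eval_pow, eval_C, eval_X, eval_ofNat]
    norm_num [WeierstrassCurve.b₂, WeierstrassCurve.b₄, WeierstrassCurve.b₆, WeierstrassCurve.b₈]
  · exact (Int.prime_iff_natAbs_prime.mpr (by norm_num)).squarefree
  · norm_num [WeierstrassCurve.b₂]

/-- Same curve, linear certificate at the other rational root `x₀ = 7/3`: `GVPar W 3`. [folklore] -/
example : GVPar (⟨1, -2, 1, 220, 1972⟩ : WeierstrassCurve ℚ) 3 := by
  haveI : (⟨1, -2, 1, 220, 1972⟩ : WeierstrassCurve ℚ).IsElliptic := ⟨by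
    rw [isUnit_iff_ne_zero]
    norm_num [WeierstrassCurve.Δ, WeierstrassCurve.b₂, WeierstrassCurve.b₄, WeierstrassCurve.b₆,
      WeierstrassCurve.b₈]⟩
  refine gvPar_three_of_linCert (x₀ := 7 / 3) (t := 1) (D := 21) ?_ ?_ (by norm_num) ?_ (by decide)
  · simp only [WeierstrassCurve.Ψ₃, eval_add, eval_mul, eval_pow, eval_C, eval_X, eval_ofNat]
    norm_num [WeierstrassCurve.b₂, WeierstrassCurve.b₄, WeierstrassCurve.b₆, WeierstrassCurve.b₈]
  · have h : Squarefree ((3 * 7 : ℕ) : ℤ) := by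
      rw [Int.squarefree_natCast, Nat.squarefree_mul_iff]
      exact ⟨by norm_num, Nat.prime_three.prime.squarefree, (by norm_num : Nat.Prime 7).prime.squarefree⟩
    exact_mod_cast h
  · norm_num [WeierstrassCurve.b₂]

end KernelDisc

end Summit.BirchSwinnertonDyer.Rank1Residual

end
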